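import Summits.QuantumFields.GaugeBoot.PlaquettePairRP
import Summits.QuantumFields.GaugeBoot.WilsonLoopLimitMonotone
import HarnessLib

/-!
# YM instrument cell — Q-A2 (α): the positivity-only decay law of the connected plaquette–plaquette correlator

Q-A2 · crew (a) · REGISTERED 2026-08-26T13:54:11Z (`pub/ym-instrument/QUESTIONS.md`; reading A-0826-9 = BOOT-PLAN §2
A-plan-2 (α) / §5.1; run-list item R-A2.0 «lean-1 structure note + typing of §5.1», 0 core-h). Cell `ym-instrument`
(HUMAN RULING D-0084 (2); director-ym R138; HOME `run/shared/lean/pub/ym-instrument/`), Lean typist seat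
`ym-instrument-boot-lean-1`. Theorems only; vocabulary `GaugeBoot/TimeAxisLoops`, `SpatialLoopHankel`, `PlaquettePairRP`.

HONEST FRAMING (page 1 of every file of this cell). WHAT IS PROVED, AT WHICH `(G, D, L, β)`: for `G = SU(N)` (any
`N`, fundamental representation, STANDARD Wilson action at `β_std = β`, tree coupling `β/N`), any dimension `D ≥ 3`
(the plaquettes lie in a coordinate plane `(i, j)` with `i, j ≠ 0`, `i ≠ j`, orthogonal to the separation axis `0`),
any `β ≥ 0`, and ANY infinite-volume limit point `μ` of the torus Wilson states `(ℤ/L)^D` along EVEN `L → ∞` (tree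
notion `IsInfiniteVolumeLimitAlong`; existence of limit points is the tree fact `infiniteVolumeLimitPoints_nonempty`, NO
uniqueness is claimed), the connected facing-plaquette correlator
`C(t) = ∫ u_P(0) u_P(t e₀) dμ - (∫ u_P dμ)²` (`limitPlaquettePairConnected`, `u_P = (1/N) Re tr U_P`) obeys
`plaquettePair_decay_law`:
  `0 ≤ C(t) ≤ 1`,  `C(t+1)² ≤ C(t) C(t+2)`,  `C` antitone and convex,  `C(1) C(t) ≤ C(0) C(t+1)`,
  and the floor `C(0) · (C(1)/C(0))^t ≤ C(t)` for every `t ∈ ℕ`,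
plus the full Hankel / shifted-Hankel positivity `0 ≤ Σ c_a c_b C(a+b)`, `0 ≤ Σ c_a c_b C(a+b+1)`
(`limitPlaquettePairConnected_hankel_site/link`; the site family needs no sign on `β`). This IS the registered
«positivity-only lower bound on the decay»: reflection positivity ALONE forbids `C` to decay faster than `e^{-m₁ t}`,
`m₁ = log (C(0)/C(1))`, and says nothing more (any such law is realised by some Stieltjes sequence); it is non-trivial
exactly when `C(1) > 0` — a NUMBER this file does not contain (certified windows for `C(0)`, `C(1)` at `β = 11/5, 9/5`
are Q-A2 (β), run-list R-A2.1–R-A2.2). NOTHING here is a mass gap (the law bounds the decay rate from ABOVE, never from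
below), a continuum statement, a string tension or summit-bearing; on a FIXED torus only the finite Hankel blocks of
heights `≤ L/2` hold (`GaugeBoot/PlaquettePairRP`, exact), never monotonicity (wrap-around `C_L(t) = C_L(L-t)`).
LADDER CONSEQUENCE (registered, informs — does not move — any item): WCR cruxes `stmt-QuantumFields-19609`
(`BulkDominatesColdBoxW`) and `stmt-QuantumFields-19608` (`ColdBoxTwoPointFloorW`), card `cruxidea-stmt-QuantumFields-19354-5`
(«RP alone floors the connected plaquette two-point function» — here as a fixed-`β` limit-state FACT of the shape
`C(t) ≥ C(0)(C(1)/C(0))^t`, whose strength is entirely in the two numbers `C(0)`, `C(1)`).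

## Mechanism (no reflection positivity OF `μ` is used)
For each fixed `t` the torus inequalities of `GaugeBoot/PlaquettePairRP` (diagonals and `2 × 2` minors of the site /
link Hankel blocks of `C_L`, from the tree's `wilsonExpectation_siteReflectionPositive` and
`wilsonExpectation_reflectionPositive_holds`) hold on every even torus of side `≥ 2t + 4`, and closed inequalities
between finitely many cylinder expectations pass to the limit (`IsInfiniteVolumeLimitAlong` = convergence on bounded
continuous cylinder observables; `tendsto_plaquettePairConnected`). The elementary core — a bounded non-negative
log-convex sequence is antitone and convex (`WilsonLoopLimit.antitone_of_sq_le_mul_of_bdd`, inherited from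
`GaugeBoot/WilsonLoopLimitMonotone`), ratio bound and geometric floor (`PlaquettePairDecay.mul_le_mul_succ_of_sq_le_mul`,
`mul_pow_div_le_of_sq_le_mul`) — is pure real analysis. This is the Lean form of BOOT-PLAN §5.1 / LIT-INDEX Amendment 7
(Montvay–Münster §3.2.6, §3.2.8, (3.435): positivity of the transfer matrix from reflection positivity, spectral sum
`C(t) = ∫ λ^t dμ_f(λ)`; K. Osterwalder, E. Seiler, Ann. Phys. 110 (1978) 440 §2; E. Seiler, LNP 159 (1982) Ch. 2). The
Hausdorff-moment representation itself is NOT formalised; the two Hankel families are its full finite content.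
Everything is `[folklore]`.
-/

noncomputable section

namespace Summit.QuantumFields.YangMills.Theorems.Instrument

open MeasureTheory Filter Topology
open Summit.QuantumFields.GaugeBoot
open Literature.MathematicalPhysics.QuantumFieldTheory
open Literature.MathematicalPhysics.QuantumLattice (LGConfig plaquetteObs plaquetteHolonomyZd toTorusObservable
  IsCylinder IsInfiniteVolumeLimitAlong)
open Literature.RepresentationTheory.CompactGroups
open Literature.Probability.LatticeModels (Torus.proj)

/-! ## Elementary core: log-convex non-negative sequences -/

namespace PlaquettePairDecay

/-- For a non-negative sequence with `f (t+1)² ≤ f t · f (t+2)`: the ratio bound `f 1 · f t ≤ f 0 · f (t+1)`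
(`m_eff(t) ≤ m_eff(1)` in lattice language). [folklore] -/
theorem mul_le_mul_succ_of_sq_le_mul (f : ℕ → ℝ) (h0 : ∀ t, 0 ≤ f t)
    (hc : ∀ t, f (t + 1) ^ 2 ≤ f t * f (t + 2)) : ∀ t : ℕ, f 1 * f t ≤ f 0 * f (t + 1)
  | 0 => by rw [mul_comm]
  | t + 1 => by
    have ih := mul_le_mul_succ_of_sq_le_mul f h0 hc t
    have hct := hc t
    rcases (h0 t).eq_or_lt with ht | ht
    · -- `f t = 0` forces `f (t+1) = 0`
      have h1 : f (t + 1) = 0 := by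
        have : f (t + 1) ^ 2 ≤ 0 := by rw [← ht, zero_mul] at hct; exact hct
        nlinarith [h0 (t + 1)]
      rw [h1, mul_zero]
      exact mul_nonneg (h0 0) (h0 (t + 2))
    · -- `f 1 f t f(t+1) ≤ f 0 f(t+1)² ≤ f 0 f t f(t+2)`, divide by `f t > 0`
      have h2 : f 1 * f (t + 1) * f t ≤ f 0 * f (t + 1 + 1) * f t := by
        have := h0 (t + 1)
        have := h0 0
        nlinarith
      exact le_of_mul_le_mul_right h2 ht

/-- For a non-negative sequence with `f (t+1)² ≤ f t · f (t+2)`: the GEOMETRIC FLOOR `f 0 · (f 1 / f 0)^t ≤ f t`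
(with `x / 0 = 0`; for `f 0 > 0` this is `f t ≥ f 0 e^{-m₁ t}`, `m₁ = log (f 0 / f 1)`). [folklore] -/
theorem mul_pow_div_le_of_sq_le_mul (f : ℕ → ℝ) (h0 : ∀ t, 0 ≤ f t)
    (hc : ∀ t, f (t + 1) ^ 2 ≤ f t * f (t + 2)) : ∀ t : ℕ, f 0 * (f 1 / f 0) ^ t ≤ f t
  | 0 => by simp
  | t + 1 => by
    rcases (h0 0).eq_or_lt with hz | hz
    · rw [← hz, zero_mul]; exact h0 _
    · have ih := mul_pow_div_le_of_sq_le_mul f h0 hc t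
      have hr : 0 ≤ f 1 / f 0 := div_nonneg (h0 1) hz.le
      have hstep := mul_le_mul_succ_of_sq_le_mul f h0 hc t
      calc f 0 * (f 1 / f 0) ^ (t + 1) = f 0 * (f 1 / f 0) ^ t * (f 1 / f 0) := by ring
        _ ≤ f t * (f 1 / f 0) := mul_le_mul_of_nonneg_right ih hr
        _ = f 1 * f t / f 0 := by ring
        _ ≤ f 0 * f (t + 1) / f 0 := div_le_div_of_nonneg_right hstep hz.le
        _ = f (t + 1) := by field_simp

end PlaquettePairDecay

/-! ## Binding to the tree: torus correlators converge at limit points along even tori -/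

section Limit

variable {D N : ℕ} [NeZero D]

/-- The torus below the `ℤ^D` site `(t, 0⃗)` is `tSite t`. [folklore] -/
theorem torusProj_single_zero (L : ℕ) (t : ℤ) :
    Torus.proj L (Pi.single (0 : Fin D) t : Literature.Probability.LatticeModels.Site D) = (tSite t : Site D L) := rfl

omit [NeZero D] in
/-- The normalised `ℤ^D` plaquette observable is a bounded continuous cylinder observable. [folklore] -/
theorem plaquetteObs_cylinder (x : Literature.Probability.LatticeModels.Site D) (i j : Fin D) :
    IsCylinder (fun U : LGConfig D (SU N) => (N : ℝ)⁻¹ * plaquetteObs (suRep N) x i j U)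
        ({(x, i), (x + Pi.single i 1, j), (x + Pi.single j 1, i), (x, j)} :
          Finset (Literature.MathematicalPhysics.QuantumLattice.ZdEdge D)) ∧
      Continuous (fun U : LGConfig D (SU N) => (N : ℝ)⁻¹ * plaquetteObs (suRep N) x i j U) ∧
      ∀ U : LGConfig D (SU N), |(N : ℝ)⁻¹ * plaquetteObs (suRep N) x i j U| ≤ 1 := by
  refine ⟨?_, ?_, ?_⟩
  · intro U V hUV
    simp only [plaquetteObs, plaquetteHolonomyZd]
    rw [hUV (x, i) (by simp), hUV (x + Pi.single i 1, j) (by simp), hUV (x + Pi.single j 1, i) (by simp),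
      hUV (x, j) (by simp)]
  · have h1 : Continuous fun U : LGConfig D (SU N) => plaquetteHolonomyZd U x i j := by
      unfold plaquetteHolonomyZd; fun_prop
    exact continuous_const.mul ((continuous_trace_re (suRep N) (continuous_suRep N)).comp h1)
  · intro U
    have h := CompactGroup.abs_re_trace_le_card (suRep N) (continuous_suRep N) (plaquetteHolonomyZd U x i j)
    rw [Fintype.card_fin] at h
    simp only [plaquetteObs]
    rcases Nat.eq_zero_or_pos N with hN | hN
    · subst hN; simp
    · rw [abs_mul, abs_inv, Nat.abs_cast]
      calc (N : ℝ)⁻¹ * |((suRep N) (plaquetteHolonomyZd U x i j)).trace.re| ≤ (N : ℝ)⁻¹ * N := by gcongr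
        _ = 1 := inv_mul_cancel₀ (by exact_mod_cast hN.ne')

omit [NeZero D] in
/-- Torus plaquette expectations converge to the `μ`-integral of the `ℤ^D` plaquette observable along the limit
sequence. [folklore] -/
theorem tendsto_wilsonExpectation_plaquetteTrace {β : ℝ} {Lk : ℕ → ℕ} {μ : Measure (LGConfig D (SU N))}
    (hμ : IsInfiniteVolumeLimitAlong (suRep N) (β / N) Lk μ) (x : Literature.Probability.LatticeModels.Site D) (i j : Fin D) :
    Tendsto (fun k => wilsonExpectation (suRep N) (β / N)
      (plaquetteTrace (suRep N) (Torus.proj (Lk k + 1) x) i j)) atTop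
      (𝓝 (∫ U, (N : ℝ)⁻¹ * plaquetteObs (suRep N) x i j U ∂μ)) := by
  obtain ⟨hcyl, hcont, hbd⟩ := plaquetteObs_cylinder (N := N) x i j
  have h := hμ.2 _ _ hcyl hcont ⟨1, hbd⟩
  simp only [toTorusObservable_plaquetteObs] at h
  exact h

/-- Torus facing-plaquette pair expectations `G_L(t)` converge to the `μ`-integral of the product of the two `ℤ^D`
plaquette observables along the limit sequence. [folklore] -/
theorem tendsto_plaquettePairCorrelator {β : ℝ} {Lk : ℕ → ℕ} {μ : Measure (LGConfig D (SU N))}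
    (hμ : IsInfiniteVolumeLimitAlong (suRep N) (β / N) Lk μ) (i j : Fin D) (t : ℕ) :
    Tendsto (fun k => plaquettePairCorrelator N D (Lk k + 1) β i j t) atTop
      (𝓝 (∫ U, ((N : ℝ)⁻¹ * plaquetteObs (suRep N) 0 i j U) *
        ((N : ℝ)⁻¹ * plaquetteObs (suRep N) (Pi.single 0 (t : ℤ)) i j U) ∂μ)) := by
  obtain ⟨hcyl₁, hcont₁, hbd₁⟩ := plaquetteObs_cylinder (N := N) (0 : Literature.Probability.LatticeModels.Site D) i j
  obtain ⟨hcyl₂, hcont₂, hbd₂⟩ := plaquetteObs_cylinder (N := N) (Pi.single 0 (t : ℤ) : Literature.Probability.LatticeModels.Site D) i j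
  set F : LGConfig D (SU N) → ℝ := fun U => ((N : ℝ)⁻¹ * plaquetteObs (suRep N) 0 i j U) *
    ((N : ℝ)⁻¹ * plaquetteObs (suRep N) (Pi.single 0 (t : ℤ)) i j U) with hF
  have hcyl : IsCylinder F
      (({((0 : Literature.Probability.LatticeModels.Site D), i), (0 + Pi.single i 1, j), (0 + Pi.single j 1, i), ((0 : Literature.Probability.LatticeModels.Site D), j)} :
          Finset (Literature.MathematicalPhysics.QuantumLattice.ZdEdge D)) ∪
        {((Pi.single 0 (t : ℤ) : Literature.Probability.LatticeModels.Site D), i), (Pi.single 0 (t : ℤ) + Pi.single i 1, j),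
          (Pi.single 0 (t : ℤ) + Pi.single j 1, i), ((Pi.single 0 (t : ℤ) : Literature.Probability.LatticeModels.Site D), j)}) := by
    intro U V hUV
    have e₁ := hcyl₁ fun e he => hUV e (Finset.mem_union_left _ he)
    have e₂ := hcyl₂ fun e he => hUV e (Finset.mem_union_right _ he)
    simp only at e₁ e₂
    simp only [hF]
    rw [e₁, e₂]
  have hcont : Continuous F := hcont₁.mul hcont₂
  have hbd : ∃ C, ∀ U, |F U| ≤ C := ⟨1, fun U => by
    rw [hF, abs_mul]; exact mul_le_one₀ (hbd₁ U) (abs_nonneg _) (hbd₂ U)⟩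
  have h := hμ.2 F _ hcyl hcont hbd
  have hT : ∀ k, toTorusObservable (Lk k + 1) F =
      (plaquettePair (suRep N) i j t : GaugeConfig D (Lk k + 1) (SU N) → ℝ) := by
    intro k
    funext V
    have h₁ := congrFun (toTorusObservable_plaquetteObs (suRep N) (Lk k + 1) (0 : Literature.Probability.LatticeModels.Site D) i j) V
    have h₂ := congrFun (toTorusObservable_plaquetteObs (suRep N) (Lk k + 1) (Pi.single 0 (t : ℤ) : Literature.Probability.LatticeModels.Site D) i j) V
    simp only [toTorusObservable, Function.comp_apply] at h₁ h₂ ⊢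
    rw [hF]
    simp only
    rw [h₁, h₂, WilsonLoopLimit.torusProj_zero, torusProj_single_zero, plaquettePair]
  simp only [hT] at h
  exact h

variable {β : ℝ} {Lk : ℕ → ℕ} {μ : Measure (LGConfig D (SU N))}

/-- **`C_L(t) → C_μ(t)`** along the limit sequence (plane `i ≠ j`). [folklore] -/
theorem tendsto_plaquettePairConnected (hμ : IsInfiniteVolumeLimitAlong (suRep N) (β / N) Lk μ) {i j : Fin D}
    (hij : i ≠ j) (t : ℕ) :
    Tendsto (fun k => plaquettePairConnected N D (Lk k + 1) β i j t) atTop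
      (𝓝 (limitPlaquettePairConnected N D μ i j t)) := by
  have h1 := tendsto_plaquettePairCorrelator hμ i j t
  have h2 := (tendsto_wilsonExpectation_plaquetteTrace hμ (0 : Literature.Probability.LatticeModels.Site D) i j).pow 2
  simp only [WilsonLoopLimit.torusProj_zero] at h2
  have h := h1.sub h2
  refine (tendsto_congr fun k => ?_).1 h
  rw [plaquettePairConnected_eq _ β hij, plaquettePairCorrelator]

/-- **Hankel positivity of `C_μ` (site planes, any real `β`)**: `0 ≤ Σ_{a,b∈S} c_a c_b C_μ(a+b)` for every finite
`S` — the limit of the torus blocks `hankel_plaquettePairConnected_nonneg_site`, valid on every even torus of side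
`> 2 max S`. LIMIT POINTS along even tori. [folklore] -/
theorem limitPlaquettePairConnected_hankel_site (hmono : StrictMono Lk) (heven : ∀ k, Even (Lk k + 1))
    (hμ : IsInfiniteVolumeLimitAlong (suRep N) (β / N) Lk μ) {i j : Fin D} (hi : i ≠ 0) (hj : j ≠ 0) (hij : i ≠ j)
    (S : Finset ℕ) (c : ℕ → ℝ) :
    0 ≤ ∑ a ∈ S, ∑ b ∈ S, c a * c b * limitPlaquettePairConnected N D μ i j (a + b) := by
  have hsum := tendsto_finsetSum S fun a _ => tendsto_finsetSum S fun b _ =>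
    (tendsto_plaquettePairConnected hμ hij (a + b)).const_mul (c a * c b)
  refine ge_of_tendsto hsum (Filter.eventually_atTop.2 ⟨2 * S.sup id + 2, fun k hk => ?_⟩)
  have hkL : k ≤ Lk k := hmono.id_le k
  exact hankel_plaquettePairConnected_nonneg_site (N := N) (Lk k + 1) (heven k) β hi hj hij S
    (fun a ha => by have h := Finset.le_sup (f := id) ha; simp only [id_eq] at h; omega) c

/-- **Shifted Hankel positivity of `C_μ` (link planes, `β ≥ 0`)**: `0 ≤ Σ_{a,b∈S} c_a c_b C_μ(a+b+1)`. Together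
with the site family: `t ↦ C_μ(t)` is a bounded positive-definite AND shifted-positive-definite function on `(ℕ,+)`
(a Stieltjes / Hausdorff moment sequence; the representing measure is not formalised). [folklore] -/
theorem limitPlaquettePairConnected_hankel_link (hβ : 0 ≤ β) (hmono : StrictMono Lk)
    (heven : ∀ k, Even (Lk k + 1)) (hμ : IsInfiniteVolumeLimitAlong (suRep N) (β / N) Lk μ) {i j : Fin D}
    (hi : i ≠ 0) (hj : j ≠ 0) (hij : i ≠ j) (S : Finset ℕ) (c : ℕ → ℝ) :
    0 ≤ ∑ a ∈ S, ∑ b ∈ S, c a * c b * limitPlaquettePairConnected N D μ i j (a + b + 1) := by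
  have hsum := tendsto_finsetSum S fun a _ => tendsto_finsetSum S fun b _ =>
    (tendsto_plaquettePairConnected hμ hij (a + b + 1)).const_mul (c a * c b)
  refine ge_of_tendsto hsum (Filter.eventually_atTop.2 ⟨2 * S.sup id + 4, fun k hk => ?_⟩)
  have hkL : k ≤ Lk k := hmono.id_le k
  exact hankel_plaquettePairConnected_nonneg_link (N := N) (Lk k + 1) (heven k) hβ hi hj hij S
    (fun a ha => by have h := Finset.le_sup (f := id) ha; simp only [id_eq] at h; omega) c

/-- **Hankel data of `C_μ`** (`β ≥ 0`): `0 ≤ C_μ(t) ≤ 1` and `C_μ(t+1)² ≤ C_μ(t) C_μ(t+2)` for every `t`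
(limits of the torus diagonals and `2 × 2` minors). [folklore] -/
theorem limitPlaquettePairConnected_hankel (hβ : 0 ≤ β) (hmono : StrictMono Lk) (heven : ∀ k, Even (Lk k + 1))
    (hμ : IsInfiniteVolumeLimitAlong (suRep N) (β / N) Lk μ) {i j : Fin D} (hi : i ≠ 0) (hj : j ≠ 0) (hij : i ≠ j) :
    let C : ℕ → ℝ := limitPlaquettePairConnected N D μ i j
    (∀ t, 0 ≤ C t) ∧ (∀ t, C t ≤ 1) ∧ (∀ t, C (t + 1) ^ 2 ≤ C t * C (t + 2)) := by
  intro C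
  have hlim : ∀ t, Tendsto (fun k => plaquettePairConnected N D (Lk k + 1) β i j t) atTop (𝓝 (C t)) :=
    fun t => tendsto_plaquettePairConnected hμ hij t
  have h0 : ∀ t, 0 ≤ C t := by
    intro t
    refine ge_of_tendsto (hlim t) (Filter.eventually_atTop.2 ⟨2 * t + 2, fun k hk => ?_⟩)
    have hkL : k ≤ Lk k := hmono.id_le k
    rcases Nat.even_or_odd t with ⟨a, rfl⟩ | ⟨a, rfl⟩
    · exact plaquettePairConnected_nonneg_even (N := N) (Lk k + 1) (heven k) β hi hj hij (a := a) (by omega)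
    · have h := plaquettePairConnected_nonneg_odd (N := N) (Lk k + 1) (heven k) hβ hi hj hij (a := a) (by omega)
      have e : a + a + 1 = 2 * a + 1 := by ring
      rw [e] at h
      exact h
  have h1 : ∀ t, C t ≤ 1 := fun t =>
    le_of_tendsto (hlim t) (Filter.Eventually.of_forall fun k =>
      plaquettePairConnected_le_one (N := N) (Lk k + 1) β i j t)
  have hc : ∀ t, C (t + 1) ^ 2 ≤ C t * C (t + 2) := by
    intro t
    refine le_of_tendsto_of_tendsto ((hlim (t + 1)).pow 2) ((hlim t).mul (hlim (t + 2)))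
      (Filter.eventually_atTop.2 ⟨2 * t + 4, fun k hk => ?_⟩)
    have hkL : k ≤ Lk k := hmono.id_le k
    rcases Nat.even_or_odd t with ⟨a, rfl⟩ | ⟨a, rfl⟩
    · have key := plaquettePairConnected_sq_le_even (N := N) (Lk k + 1) (heven k) β hi hj hij
        (a := a) (b := a + 1) (by omega) (by omega)
      have e1 : a + (a + 1) = a + a + 1 := by ring
      have e2 : a + 1 + (a + 1) = a + a + 2 := by ring
      rw [e1, e2] at key
      exact key
    · have key := plaquettePairConnected_sq_le_odd (N := N) (Lk k + 1) (heven k) hβ hi hj hij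
        (a := a) (b := a + 1) (by omega) (by omega)
      have e1 : a + (a + 1) + 1 = 2 * a + 1 + 1 := by ring
      have e2 : a + a + 1 = 2 * a + 1 := by ring
      have e3 : a + 1 + (a + 1) + 1 = 2 * a + 1 + 2 := by ring
      rw [e1, e2, e3] at key
      exact key
  exact ⟨h0, h1, hc⟩

/-- **THE POSITIVITY-ONLY DECAY LAW (Q-A2 (α)).** For `SU(N)` lattice gauge theory in `D ≥ 3` dimensions at
standard Wilson coupling `β ≥ 0`, any infinite-volume limit point `μ` of the torus Wilson states along EVEN tori,
and a coordinate plane `(i, j)` orthogonal to the separation axis (`i, j ≠ 0`, `i ≠ j`), the connected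
facing-plaquette correlator `C(t) = C_μ(t)` satisfies, FROM REFLECTION POSITIVITY ALONE:
`0 ≤ C(t) ≤ 1`; `C(t+1)² ≤ C(t) C(t+2)` (log-convex); `C` is ANTITONE and three-term CONVEX; the effective-mass
bound `C(1) C(t) ≤ C(0) C(t+1)`; and the GEOMETRIC FLOOR `C(0) (C(1)/C(0))^t ≤ C(t)` — reflection positivity
forbids decay faster than `e^{-m₁ t}`, `m₁ = log (C(0)/C(1))`, and this floor is non-trivial exactly when `C(1) > 0`.
HONEST FRAMING: LIMIT POINTS ONLY (no uniqueness of the limit claimed; on a fixed torus only the finite Hankel blocks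
hold); a statement at the stated `(SU(N), D, β)`; NOT a mass gap (it bounds the decay rate from ABOVE by `m₁`, it
does not bound it from below), NOT a continuum statement, nothing summit-bearing. [folklore] -/
theorem plaquettePair_decay_law (hβ : 0 ≤ β) (hmono : StrictMono Lk) (heven : ∀ k, Even (Lk k + 1))
    (hμ : IsInfiniteVolumeLimitAlong (suRep N) (β / N) Lk μ) {i j : Fin D} (hi : i ≠ 0) (hj : j ≠ 0) (hij : i ≠ j) :
    let C : ℕ → ℝ := limitPlaquettePairConnected N D μ i j
    (∀ t, 0 ≤ C t) ∧ (∀ t, C t ≤ 1) ∧ (∀ t, C (t + 1) ^ 2 ≤ C t * C (t + 2)) ∧ Antitone C ∧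
      (∀ t, 2 * C (t + 1) ≤ C t + C (t + 2)) ∧ (∀ t, C 1 * C t ≤ C 0 * C (t + 1)) ∧
      (∀ t, C 0 * (C 1 / C 0) ^ t ≤ C t) := by
  intro C
  obtain ⟨h0, h1, hc⟩ := limitPlaquettePairConnected_hankel hβ hmono heven hμ hi hj hij
  exact ⟨h0, h1, hc, WilsonLoopLimit.antitone_of_sq_le_mul_of_bdd _ h0 h1 hc,
    WilsonLoopLimit.two_mul_le_add_of_sq_le_mul _ h0 hc, PlaquettePairDecay.mul_le_mul_succ_of_sq_le_mul _ h0 hc,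
    PlaquettePairDecay.mul_pow_div_le_of_sq_le_mul _ h0 hc⟩

end Limit

end Summit.QuantumFields.YangMills.Theorems.Instrument


end
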